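import Literature.Barriers.Parity.SiegelZeroDichotomyPairHLProp81Regimes
import Literature.Barriers.Parity.SiegelZeroDichotomyPairHLSixSlotEuler
import HarnessLib

/-!
# Tao–Teräväinen 2022, §8 (`k = 2`): integrating the kernel bounds against the weight

Topic `Literature/Barriers/Parity`, sub-namespace `TaoTeravainen`; assembly step of Proposition 8.1 in
the proof DAG of `Literature.Barriers.Parity.TaoTeravainen2021_prop72_81_pair` (T. Tao, J. Teräväinen,
*The Hardy–Littlewood–Chowla conjecture in the presence of a Siegel zero*, J. London Math. Soc. (2) 106
(2022), arXiv:2109.06291), §8 between (8.19) and (8.25): the crude bound "`∏_p E_p ≪ log^{O(1)} R`"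
restricts the Fourier variables to `|t| ≤ log^{1/10} R`, the refined bound (8.20)
"`∏_{p≥C} E_p ≪_C (1+|t|)^{O(1)} log^{-k} R`" restricts them to (8.21) `|t| ≤ log^{1/(100k)} η`, and on
that regime (8.25) `∏_p E_p = 𝔖 log^{-k}x ∏_j(1+t_{0,j}) + O(log^{-k}x/log^{1/(7k)}η)`.

This file is the PROVED integration step, with the three kernel bounds as HYPOTHESES on an arbitrary
kernel `K` (in the units of `…SixSlotEuler.lean`: `t_{0,j} = 2πXτ_{(j,0)}`, `t_{i,j} = 2πτ_{(j,i)}`):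
`hKB1 : ‖K‖ ≤ A₁` everywhere, `hKB2 : ‖K‖ ≤ A₂ X⁻² P(τ)` on the box `|t| ≤ T`,
`hKB3 : ‖K − 𝔖'M‖ ≤ A₃ X⁻² P(τ)` on the box `|t| ≤ T'`, and the model bound `hMB : ‖M‖ ≤ A₄ X⁻² ∏_j(1+X|τ_{j,0}|)²`,
where `P(τ) = ∏_j (1+X|τ_{j,0}|)^κ ∏_{i≥1}(1+|τ_{j,i}|)^κ` (`polyWeight`):

* `slotPoly`, `polyWeight`, `boxThr`, `kernelErr` (the piecewise error), `kernelErr_bound` (it dominates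
  `‖K − 𝔖'M‖`);
* **`integral_kernelErr_mul_norm_sixWeight_le`** — `∫ kernelErr · |W_y| ≤ X⁻²(A₃ I_d²I_s⁴ + (A₂+|𝔖'|A₄) Σ(T') + A₁X² Σ(T))`
  with the slot integrals `I`, tails `J` of `…Prop81Weights/Regimes.lean`.
  [cite: TaoTeravainen2021, §8 (8.19)–(8.21) and (8.25)]
-/

noncomputable section

open Real MeasureTheory Finset Set

namespace Literature.Barriers.Parity

namespace TaoTeravainen

/-! ### The polynomial weight and the boxes -/

/-- The polynomial growth allowed in slot `k`: `(1 + X|t|)^κ` in a `d`-slot, `(1+|t|)^κ` in a sieve slot.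
[cite: TaoTeravainen2021, §8 (8.20) ("`(1+|t|)^{O(1)}`")] -/
def slotPoly (X : ℝ) (κ : ℕ) (k : Slot) (t : ℝ) : ℝ :=
  if k.2 = 0 then (1 + X * |t|) ^ κ else (1 + |t|) ^ κ

/-- `P(τ) = ∏_k slotPoly_k(τ_k)`. [cite: TaoTeravainen2021, §8 (8.20)] -/
def polyWeight (X : ℝ) (κ : ℕ) (τ : Slot → ℝ) : ℝ := ∏ k : Slot, slotPoly X κ k (τ k)

/-- The box `|t| ≤ T` in `τ`-units: `|τ_{(j,0)}| ≤ T/(2πX)`, `|τ_{(j,i)}| ≤ T/(2π)`.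
[cite: TaoTeravainen2021, §8 (8.21)] -/
def boxThr (X T : ℝ) (k : Slot) : ℝ := if k.2 = 0 then T / (2 * π * X) else T / (2 * π)

/-- `1 ≤ slotPoly` (`X ≥ 0`). [folklore] -/
theorem one_le_slotPoly {X : ℝ} (hX : 0 ≤ X) (κ : ℕ) (k : Slot) (t : ℝ) : 1 ≤ slotPoly X κ k t := by
  unfold slotPoly
  split_ifs
  · exact one_le_pow₀ (by have := abs_nonneg t; nlinarith)
  · exact one_le_pow₀ (by have := abs_nonneg t; linarith)

/-- `0 ≤ polyWeight` and `∏_j (1 + X|τ_{j,0}|)² ≤ polyWeight` for `κ ≥ 2`, `X ≥ 0`. [folklore] -/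
theorem prod_sq_le_polyWeight {X : ℝ} (hX : 0 ≤ X) {κ : ℕ} (hκ : 2 ≤ κ) (τ : Slot → ℝ) :
    0 ≤ polyWeight X κ τ ∧ ∏ j : Fin 2, (1 + X * |τ (j, 0)|) ^ 2 ≤ polyWeight X κ τ := by
  have h1 : ∀ k, 1 ≤ slotPoly X κ k (τ k) := fun k => one_le_slotPoly hX κ k (τ k)
  refine ⟨prod_nonneg fun k _ => zero_le_one.trans (h1 k), ?_⟩
  unfold polyWeight
  rw [Fintype.prod_prod_type]
  refine prod_le_prod (fun j _ => by positivity) fun j _ => ?_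
  rw [Fin.prod_univ_three]
  have h0 : (1 + X * |τ (j, 0)|) ^ 2 ≤ slotPoly X κ (j, 0) (τ (j, 0)) := by
    unfold slotPoly; simp only [if_true]
    exact pow_le_pow_right₀ (by have := abs_nonneg (τ (j, 0)); nlinarith) hκ
  have hA : 0 ≤ slotPoly X κ (j, 0) (τ (j, 0)) := zero_le_one.trans (h1 _)
  calc (1 + X * |τ (j, 0)|) ^ 2 ≤ slotPoly X κ (j, 0) (τ (j, 0)) * 1 * 1 := by rw [mul_one, mul_one]; exact h0
    _ ≤ slotPoly X κ (j, 0) (τ (j, 0)) * slotPoly X κ (j, 1) (τ (j, 1)) * slotPoly X κ (j, 2) (τ (j, 2)) :=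
        mul_le_mul (mul_le_mul_of_nonneg_left (h1 _) hA) (h1 _) zero_le_one (mul_nonneg hA (zero_le_one.trans (h1 _)))

/-! ### The piecewise error -/

/-- The piecewise error `X⁻² P(τ) (A₃ + 1_{τ ∉ Box(T')} (A₂ + |𝔖'|A₄) + 1_{τ ∉ Box(T)} A₁X²)`.
[cite: TaoTeravainen2021, §8 (the two restrictions of `|t|` and (8.25))] -/
def kernelErr (X T T' A₁ A₂ A₃ A₄ S' : ℝ) (κ : ℕ) (τ : Slot → ℝ) : ℝ :=
  (X ^ 2)⁻¹ * polyWeight X κ τ *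
    (A₃ + {τ : Slot → ℝ | ∃ k, boxThr X T' k < |τ k|}.indicator (fun _ => A₂ + |S'| * A₄) τ +
      {τ : Slot → ℝ | ∃ k, boxThr X T k < |τ k|}.indicator (fun _ => A₁ * X ^ 2) τ)

/-- **The piecewise error dominates `‖K − 𝔖'M‖`** under the three kernel bounds and the model bound
(`κ ≥ 2`, `X > 0`, `A_i ≥ 0`). [cite: TaoTeravainen2021, §8 (8.19)–(8.25)] -/
theorem kernelErr_bound {X T T' A₁ A₂ A₃ A₄ : ℝ} (hX : 0 < X) (hA₁ : 0 ≤ A₁) (hA₂ : 0 ≤ A₂)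
    (hA₃ : 0 ≤ A₃) (hA₄ : 0 ≤ A₄) {κ : ℕ} (hκ : 2 ≤ κ) {K M : (Slot → ℝ) → ℂ} {S' : ℝ}
    (hKB1 : ∀ τ, ‖K τ‖ ≤ A₁)
    (hKB2 : ∀ τ, (∀ k, |τ k| ≤ boxThr X T k) → ‖K τ‖ ≤ A₂ * (X ^ 2)⁻¹ * polyWeight X κ τ)
    (hKB3 : ∀ τ, (∀ k, |τ k| ≤ boxThr X T' k) → ‖K τ - (S' : ℂ) * M τ‖ ≤ A₃ * (X ^ 2)⁻¹ * polyWeight X κ τ)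
    (hMB : ∀ τ, ‖M τ‖ ≤ A₄ * (X ^ 2)⁻¹ * ∏ j : Fin 2, (1 + X * |τ (j, 0)|) ^ 2) (τ : Slot → ℝ) :
    ‖K τ - (S' : ℂ) * M τ‖ ≤ kernelErr X T T' A₁ A₂ A₃ A₄ S' κ τ := by
  obtain ⟨hP0, hP2⟩ := prod_sq_le_polyWeight hX.le hκ τ
  have hX2 : 0 < (X ^ 2)⁻¹ := by positivity
  have hmodel : ‖(S' : ℂ) * M τ‖ ≤ |S'| * A₄ * ((X ^ 2)⁻¹ * polyWeight X κ τ) := by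
    rw [norm_mul, Complex.norm_real, Real.norm_eq_abs]
    calc |S'| * ‖M τ‖ ≤ |S'| * (A₄ * (X ^ 2)⁻¹ * ∏ j : Fin 2, (1 + X * |τ (j, 0)|) ^ 2) :=
          mul_le_mul_of_nonneg_left (hMB τ) (abs_nonneg _)
      _ ≤ |S'| * (A₄ * (X ^ 2)⁻¹ * polyWeight X κ τ) := by gcongr
      _ = |S'| * A₄ * ((X ^ 2)⁻¹ * polyWeight X κ τ) := by ring
  unfold kernelErr
  by_cases h3 : ∀ k, |τ k| ≤ boxThr X T' k
  · -- inside the small box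
    have hind1 : 0 ≤ {τ : Slot → ℝ | ∃ k, boxThr X T' k < |τ k|}.indicator (fun _ => A₂ + |S'| * A₄) τ :=
      Set.indicator_nonneg (fun _ _ => by positivity) _
    have hind2 : 0 ≤ {τ : Slot → ℝ | ∃ k, boxThr X T k < |τ k|}.indicator (fun _ => A₁ * X ^ 2) τ :=
      Set.indicator_nonneg (fun _ _ => by positivity) _
    calc ‖K τ - (S' : ℂ) * M τ‖ ≤ A₃ * (X ^ 2)⁻¹ * polyWeight X κ τ := hKB3 τ h3
      _ = (X ^ 2)⁻¹ * polyWeight X κ τ * A₃ := by ring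
      _ ≤ _ := by gcongr; linarith
  · have hmem' : τ ∈ {τ : Slot → ℝ | ∃ k, boxThr X T' k < |τ k|} := by
      simp only [mem_setOf_eq]; push Not at h3; exact h3
    rw [Set.indicator_of_mem hmem']
    by_cases h2 : ∀ k, |τ k| ≤ boxThr X T k
    · have hind2 : 0 ≤ {τ : Slot → ℝ | ∃ k, boxThr X T k < |τ k|}.indicator (fun _ => A₁ * X ^ 2) τ :=
        Set.indicator_nonneg (fun _ _ => by positivity) _
      calc ‖K τ - (S' : ℂ) * M τ‖ ≤ ‖K τ‖ + ‖(S' : ℂ) * M τ‖ := norm_sub_le _ _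
        _ ≤ A₂ * (X ^ 2)⁻¹ * polyWeight X κ τ + |S'| * A₄ * ((X ^ 2)⁻¹ * polyWeight X κ τ) :=
            add_le_add (hKB2 τ h2) hmodel
        _ = (X ^ 2)⁻¹ * polyWeight X κ τ * (A₂ + |S'| * A₄) := by ring
        _ ≤ _ := by
            have : 0 ≤ (X ^ 2)⁻¹ * polyWeight X κ τ := by positivity
            nlinarith
    · have hmem : τ ∈ {τ : Slot → ℝ | ∃ k, boxThr X T k < |τ k|} := by
        simp only [mem_setOf_eq]; push Not at h2; exact h2
      rw [Set.indicator_of_mem hmem]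
      have hP1 : 1 ≤ polyWeight X κ τ := by
        have : (1 : ℝ) ≤ ∏ j : Fin 2, (1 + X * |τ (j, 0)|) ^ 2 := by
          rw [Fin.prod_univ_two]
          have h0 : ∀ j : Fin 2, 1 ≤ (1 + X * |τ (j, 0)|) ^ 2 := fun j =>
            one_le_pow₀ (by have := abs_nonneg (τ (j, 0)); nlinarith)
          nlinarith [h0 0, h0 1]
        exact this.trans hP2
      calc ‖K τ - (S' : ℂ) * M τ‖ ≤ ‖K τ‖ + ‖(S' : ℂ) * M τ‖ := norm_sub_le _ _
        _ ≤ A₁ + |S'| * A₄ * ((X ^ 2)⁻¹ * polyWeight X κ τ) := add_le_add (hKB1 τ) hmodel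
        _ ≤ A₁ * X ^ 2 * ((X ^ 2)⁻¹ * polyWeight X κ τ) + |S'| * A₄ * ((X ^ 2)⁻¹ * polyWeight X κ τ) := by
            gcongr
            calc A₁ = A₁ * X ^ 2 * ((X ^ 2)⁻¹ * 1) := by field_simp
              _ ≤ A₁ * X ^ 2 * ((X ^ 2)⁻¹ * polyWeight X κ τ) := by gcongr
        _ = (X ^ 2)⁻¹ * polyWeight X κ τ * (|S'| * A₄ + A₁ * X ^ 2) := by ring
        _ ≤ _ := by
            have : 0 ≤ (X ^ 2)⁻¹ * polyWeight X κ τ := by positivity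
            nlinarith

/-! ### The slot integrals and tails -/

/-- The bound `I_k` for `∫ slotPoly_k |w_k|`: `(X/U₀)^κ D_{κ+2} π/U₀` in a `d`-slot, `C_{κ+2} π` in a sieve
slot. [cite: TaoTeravainen2021, Lemma 8.2 (8.14)] -/
def slotI (M Cs : ℕ → ℝ) (X U₀ : ℝ) (κ : ℕ) (k : Slot) : ℝ :=
  if k.2 = 0 then (X / U₀) ^ κ * psiDecayConst M X U₀ (κ + 2) * (π / U₀) else Cs (κ + 2) * π

/-- The tail bound `J_k(T)` for `∫_{|τ|>thr_k(T)} slotPoly_k |w_k|`. [cite: TaoTeravainen2021, Lemma 8.2 (8.14)] -/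
def slotJ (M Cs : ℕ → ℝ) (X U₀ : ℝ) (κ nd : ℕ) (T : ℝ) (k : Slot) : ℝ :=
  if k.2 = 0 then (X / U₀) ^ κ * psiDecayConst M X U₀ (κ + nd + 2) * ((1 + U₀ * (T / (2 * π * X))) ^ nd)⁻¹ * (π / U₀)
  else Cs (κ + nd + 2) * ((1 + T / (2 * π)) ^ nd)⁻¹ * π

/-- `Σ(T) = ∑_k J_k(T) ∏_{k'≠k} I_{k'}`. [folklore] -/
def tailSum (M Cs : ℕ → ℝ) (X U₀ : ℝ) (κ nd : ℕ) (T : ℝ) : ℝ :=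
  ∑ k : Slot, slotJ M Cs X U₀ κ nd T k * ∏ k' ∈ univ.erase k, slotI M Cs X U₀ κ k'

/-- **Integrating the piecewise error against the weight.** With `|ψ⁽ⁱ⁾| ≤ M_i`, `(1+|τ|)ⁿ|f| ≤ C_n`,
`1 ≤ U₀ ≤ X`, `2U₀ + 2 ≤ X`, `log(y + h_j) ≤ X + 1`, `T, T' ≥ 0`, `A_i ≥ 0`:
`∫ kernelErr(τ) |W_y(τ)| dτ ≤ X⁻² (A₃ ∏_k I_k + (A₂ + |𝔖'|A₄) Σ(T') + A₁X² Σ(T))`, and the integrand is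
integrable. [cite: TaoTeravainen2021, §8 (the restrictions of `|t|`, via (8.14)–(8.15))] -/
theorem integral_kernelErr_mul_norm_sixWeight_le {φ ψ : ℝ → ℝ} (hφ : IsBump φ) (hψ : IsSmoothCutoff ψ)
    {M : ℕ → ℝ} (hM : ∀ i u, |iteratedDeriv i ψ u| ≤ M i) {Cs : ℕ → ℝ}
    (hCs : ∀ n τ, (1 + |τ|) ^ n * ‖sieveFourier ψ τ‖ ≤ Cs n) {X U₀ : ℝ} (hU₀ : 1 ≤ U₀) (hX : 2 * U₀ + 2 ≤ X)
    (hXU : U₀ ≤ X) (h₁ h₂ : ℕ) {y : ℝ} (hc : ∀ j : Fin 2, Real.log (y + (if j = 0 then h₁ else h₂ : ℕ)) ≤ X + 1)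
    (κ nd : ℕ) {T T' A₁ A₂ A₃ A₄ : ℝ} (hT : 0 ≤ T) (hT' : 0 ≤ T') (hA₁ : 0 ≤ A₁) (hA₂ : 0 ≤ A₂) (hA₃ : 0 ≤ A₃)
    (hA₄ : 0 ≤ A₄) (S' : ℝ) :
    Integrable (fun τ => kernelErr X T T' A₁ A₂ A₃ A₄ S' κ τ * ‖sixWeight φ ψ X U₀ h₁ h₂ y τ‖) ∧
      ∫ τ, kernelErr X T T' A₁ A₂ A₃ A₄ S' κ τ * ‖sixWeight φ ψ X U₀ h₁ h₂ y τ‖ ≤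
        (X ^ 2)⁻¹ * (A₃ * ∏ k : Slot, slotI M Cs X U₀ κ k + (A₂ + |S'| * A₄) * tailSum M Cs X U₀ κ nd T' +
          A₁ * X ^ 2 * tailSum M Cs X U₀ κ nd T) := by
  classical
  have hU₀0 : 0 < U₀ := by linarith
  have hX0 : 0 < X := by linarith
  have hXU1 : 1 ≤ X / U₀ := by rw [le_div_iff₀ hU₀0, one_mul]; exact hXU
  have hM0 : ∀ i, 0 ≤ M i := fun i => (abs_nonneg _).trans (hM i 0)
  have hCs0 : ∀ n, 0 ≤ Cs n := fun n => le_trans (by positivity) (hCs n 0)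
  -- the one-dimensional majorants
  set a : Slot → ℝ → ℝ := fun k t => slotPoly X κ k t * ‖slotTransform φ ψ X U₀ h₁ h₂ y k t‖ with ha
  have ha0 : ∀ k t, 0 ≤ a k t := fun k t =>
    mul_nonneg (zero_le_one.trans (one_le_slotPoly hX0.le κ k t)) (norm_nonneg _)
  -- `(1 + X|t|)^κ ≤ (X/U₀)^κ (1 + U₀|t|)^κ`
  have hdpoly : ∀ t : ℝ, (1 + X * |t|) ^ κ ≤ (X / U₀) ^ κ * (1 + U₀ * |t|) ^ κ := by
    intro t
    rw [← mul_pow]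
    refine pow_le_pow_left₀ (by positivity) ?_ κ
    have : X / U₀ * (1 + U₀ * |t|) = X / U₀ + X * |t| := by field_simp
    rw [this]; linarith
  have hcj : ∀ j : Fin 2, Real.log (y + (if j = 0 then h₁ else h₂ : ℕ)) ≤ X + 1 := hc
  -- integrals and tails per slot
  have hI : ∀ k, Integrable (a k) ∧ ∫ t, a k t ≤ slotI M Cs X U₀ κ k ∧
      ∀ θT : ℝ, 0 ≤ θT → ∫ t in {t : ℝ | boxThr X θT k < |t|}, a k t ≤ slotJ M Cs X U₀ κ nd θT k := by
    intro k
    by_cases hk : k.2 = 0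
    · -- `d`-slot
      have hpt : ∀ t, a k t ≤ (X / U₀) ^ κ * ((1 + U₀ * |t|) ^ κ * ‖psiFourier φ ψ X U₀ (Real.log (y + (if k.1 = 0 then h₁ else h₂ : ℕ))) t‖) := by
        intro t
        simp only [ha, slotPoly, slotTransform, hk, if_true]
        rw [← mul_assoc]
        exact mul_le_mul_of_nonneg_right (hdpoly t) (norm_nonneg _)
      obtain ⟨hint, hle⟩ := integral_pow_mul_norm_psiFourier_le hφ hψ hM hU₀ hX (hcj k.1) κ
      have hmeas : AEStronglyMeasurable (a k) := by
        have hcontF : Continuous (psiFourier φ ψ X U₀ (Real.log (y + (if k.1 = 0 then h₁ else h₂ : ℕ)))) :=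
          VectorFourier.fourierIntegral_continuous Real.continuous_fourierChar (by exact continuous_inner)
            ((contDiff_psiTwist hφ hψ X hU₀0 _).continuous.integrable_of_hasCompactSupport
              (hasCompactSupport_psiTwist hφ hψ X hU₀0 _))
        have : Continuous (a k) := by
          simp only [ha, slotPoly, slotTransform, hk, if_true]; fun_prop
        exact this.aestronglyMeasurable
      have hak : Integrable (a k) :=
        (hint.const_mul ((X / U₀) ^ κ)).mono' hmeas (Filter.Eventually.of_forall fun t => by
          rw [Real.norm_of_nonneg (ha0 k t)]; exact hpt t)
      refine ⟨hak, ?_, fun θT hθT => ?_⟩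
      · calc ∫ t, a k t ≤ ∫ t, (X / U₀) ^ κ * ((1 + U₀ * |t|) ^ κ * ‖psiFourier φ ψ X U₀ (Real.log (y + (if k.1 = 0 then h₁ else h₂ : ℕ))) t‖) :=
              integral_mono hak (hint.const_mul _) hpt
          _ ≤ (X / U₀) ^ κ * (psiDecayConst M X U₀ (κ + 2) * (π / U₀)) := by
              rw [integral_const_mul]; exact mul_le_mul_of_nonneg_left hle (by positivity)
          _ = slotI M Cs X U₀ κ k := by simp only [slotI, hk, if_true]; ring
      · have hθ : 0 ≤ boxThr X θT k := by simp only [boxThr, hk, if_true]; positivity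
        have htail := setIntegral_pow_mul_norm_psiFourier_tail_le hφ hψ hM hU₀ hX (hcj k.1) κ nd hθ
        have hS : MeasurableSet {t : ℝ | boxThr X θT k < |t|} := measurableSet_lt measurable_const measurable_abs
        calc ∫ t in {t : ℝ | boxThr X θT k < |t|}, a k t
            ≤ ∫ t in {t : ℝ | boxThr X θT k < |t|}, (X / U₀) ^ κ * ((1 + U₀ * |t|) ^ κ *
                ‖psiFourier φ ψ X U₀ (Real.log (y + (if k.1 = 0 then h₁ else h₂ : ℕ))) t‖) :=
              setIntegral_mono_on hak.integrableOn (hint.const_mul _).integrableOn hS fun t _ => hpt t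
          _ ≤ (X / U₀) ^ κ * (psiDecayConst M X U₀ (κ + nd + 2) * ((1 + U₀ * boxThr X θT k) ^ nd)⁻¹ * (π / U₀)) := by
              rw [integral_const_mul]; exact mul_le_mul_of_nonneg_left htail (by positivity)
          _ = slotJ M Cs X U₀ κ nd θT k := by simp only [slotJ, boxThr, hk, if_true]; ring
    · -- sieve slot
      have hpt : ∀ t, a k t = (1 + |t|) ^ κ * ‖sieveFourier ψ t‖ := by
        intro t; simp only [ha, slotPoly, slotTransform, hk, if_false]
      have hfun : a k = fun t => (1 + |t|) ^ κ * ‖sieveFourier ψ t‖ := funext hpt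
      rw [hfun]
      refine ⟨integrable_pow_mul_norm_sieveFourier hψ κ, ?_, fun θT hθT => ?_⟩
      · calc ∫ t, (1 + |t|) ^ κ * ‖sieveFourier ψ t‖ ≤ Cs (κ + 2) * π :=
              integral_pow_mul_norm_sieveFourier_le hψ κ (hCs (κ + 2))
          _ = slotI M Cs X U₀ κ k := by simp only [slotI, hk, if_false]
      · have hθ : 0 ≤ boxThr X θT k := by simp only [boxThr, hk, if_false]; positivity
        calc ∫ t in {t : ℝ | boxThr X θT k < |t|}, (1 + |t|) ^ κ * ‖sieveFourier ψ t‖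
            ≤ Cs (κ + nd + 2) * ((1 + boxThr X θT k) ^ nd)⁻¹ * π :=
              setIntegral_pow_mul_norm_sieveFourier_tail_le hψ κ nd (hCs (κ + nd + 2)) hθ
          _ = slotJ M Cs X U₀ κ nd θT k := by simp only [slotJ, boxThr, hk, if_false]
  -- the product majorant and its three integrals
  have hprod_eq : ∀ τ, polyWeight X κ τ * ‖sixWeight φ ψ X U₀ h₁ h₂ y τ‖ = ∏ k, a k (τ k) := by
    intro τ
    unfold polyWeight sixWeight
    rw [norm_prod, ← prod_mul_distrib]
  obtain ⟨hPint, hPle⟩ := integral_pi_prod_le_prod a ha0 (fun k => (hI k).1) (fun k => (hI k).2.1)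
  have hbox : ∀ θT : ℝ, 0 ≤ θT →
      Integrable (fun τ : Slot → ℝ => {τ : Slot → ℝ | ∃ k, boxThr X θT k < |τ k|}.indicator (fun τ => ∏ k, a k (τ k)) τ) ∧
      ∫ τ : Slot → ℝ, {τ : Slot → ℝ | ∃ k, boxThr X θT k < |τ k|}.indicator (fun τ => ∏ k, a k (τ k)) τ ≤
        tailSum M Cs X U₀ κ nd θT := by
    intro θT hθT
    have hmeas : MeasurableSet {τ : Slot → ℝ | ∃ k, boxThr X θT k < |τ k|} := by
      have : {τ : Slot → ℝ | ∃ k, boxThr X θT k < |τ k|} = ⋃ k, {τ : Slot → ℝ | boxThr X θT k < |τ k|} := by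
        ext τ; simp
      rw [this]
      exact MeasurableSet.iUnion fun k => measurableSet_lt measurable_const ((measurable_pi_apply k).abs)
    refine ⟨hPint.indicator hmeas, ?_⟩
    exact integral_compl_box_prod_le a ha0 (fun k => (hI k).1) (fun k => (hI k).2.1) (fun k => boxThr X θT k)
      (fun k => (hI k).2.2 θT hθT)
  obtain ⟨hB'int, hB'le⟩ := hbox T' hT'
  obtain ⟨hBint, hBle⟩ := hbox T hT
  -- rewrite the integrand
  have hrew : ∀ τ, kernelErr X T T' A₁ A₂ A₃ A₄ S' κ τ * ‖sixWeight φ ψ X U₀ h₁ h₂ y τ‖ =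
      (X ^ 2)⁻¹ * (A₃ * ∏ k, a k (τ k) +
        (A₂ + |S'| * A₄) * {τ : Slot → ℝ | ∃ k, boxThr X T' k < |τ k|}.indicator (fun τ => ∏ k, a k (τ k)) τ +
        A₁ * X ^ 2 * {τ : Slot → ℝ | ∃ k, boxThr X T k < |τ k|}.indicator (fun τ => ∏ k, a k (τ k)) τ) := by
    intro τ
    unfold kernelErr
    rw [show (X ^ 2)⁻¹ * polyWeight X κ τ *
        (A₃ + {τ : Slot → ℝ | ∃ k, boxThr X T' k < |τ k|}.indicator (fun _ => A₂ + |S'| * A₄) τ +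
          {τ : Slot → ℝ | ∃ k, boxThr X T k < |τ k|}.indicator (fun _ => A₁ * X ^ 2) τ) *
        ‖sixWeight φ ψ X U₀ h₁ h₂ y τ‖ =
        (X ^ 2)⁻¹ * ((A₃ + {τ : Slot → ℝ | ∃ k, boxThr X T' k < |τ k|}.indicator (fun _ => A₂ + |S'| * A₄) τ +
          {τ : Slot → ℝ | ∃ k, boxThr X T k < |τ k|}.indicator (fun _ => A₁ * X ^ 2) τ) *
          (polyWeight X κ τ * ‖sixWeight φ ψ X U₀ h₁ h₂ y τ‖)) by ring, hprod_eq τ]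
    congr 1
    simp only [Set.indicator]
    split_ifs <;> ring
  have hfun : (fun τ => kernelErr X T T' A₁ A₂ A₃ A₄ S' κ τ * ‖sixWeight φ ψ X U₀ h₁ h₂ y τ‖) =
      fun τ => (X ^ 2)⁻¹ * (A₃ * ∏ k, a k (τ k) +
        (A₂ + |S'| * A₄) * {τ : Slot → ℝ | ∃ k, boxThr X T' k < |τ k|}.indicator (fun τ => ∏ k, a k (τ k)) τ +
        A₁ * X ^ 2 * {τ : Slot → ℝ | ∃ k, boxThr X T k < |τ k|}.indicator (fun τ => ∏ k, a k (τ k)) τ) :=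
    funext hrew
  have hsum_int : Integrable fun τ : Slot → ℝ => A₃ * ∏ k, a k (τ k) +
      (A₂ + |S'| * A₄) * {τ : Slot → ℝ | ∃ k, boxThr X T' k < |τ k|}.indicator (fun τ => ∏ k, a k (τ k)) τ +
      A₁ * X ^ 2 * {τ : Slot → ℝ | ∃ k, boxThr X T k < |τ k|}.indicator (fun τ => ∏ k, a k (τ k)) τ :=
    ((hPint.const_mul _).add (hB'int.const_mul _)).add (hBint.const_mul _)
  rw [hfun]
  refine ⟨hsum_int.const_mul _, ?_⟩
  have h1 : Integrable (fun τ : Slot → ℝ => A₃ * ∏ k, a k (τ k)) := hPint.const_mul _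
  have h2 : Integrable (fun τ : Slot → ℝ =>
      (A₂ + |S'| * A₄) * {τ : Slot → ℝ | ∃ k, boxThr X T' k < |τ k|}.indicator (fun τ => ∏ k, a k (τ k)) τ) :=
    hB'int.const_mul _
  have h3 : Integrable (fun τ : Slot → ℝ =>
      A₁ * X ^ 2 * {τ : Slot → ℝ | ∃ k, boxThr X T k < |τ k|}.indicator (fun τ => ∏ k, a k (τ k)) τ) :=
    hBint.const_mul _
  have h12 : Integrable (fun τ : Slot → ℝ => A₃ * ∏ k, a k (τ k) +
      (A₂ + |S'| * A₄) * {τ : Slot → ℝ | ∃ k, boxThr X T' k < |τ k|}.indicator (fun τ => ∏ k, a k (τ k)) τ) := h1.add h2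
  rw [integral_const_mul, integral_add h12 h3, integral_add h1 h2, integral_const_mul, integral_const_mul, integral_const_mul]
  refine mul_le_mul_of_nonneg_left ?_ (by positivity)
  have hSA : 0 ≤ A₂ + |S'| * A₄ := by positivity
  exact add_le_add (add_le_add (mul_le_mul_of_nonneg_left hPle hA₃) (mul_le_mul_of_nonneg_left hB'le hSA))
    (mul_le_mul_of_nonneg_left hBle (by positivity))


end TaoTeravainen

end Literature.Barriers.Parity
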